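import Summits.HodgeConjecture.HodgeConjecture.Theorems.Ring2ClassTargets
import Literature.AlgebraicGeometry.HodgeTheory.TankeevExceptionalNumbersHodgeClasses
import HarnessLib

/-!
# Ring 2 · atlas-2 (generation 20) — the row `g6.I(1)` of the `g = 6` atlas (simple sixfolds with `End(A) = ℤ`): all powers, their isogeny classes and factors, modulo Tankeev 1996 Thm. 1.1 (first case) — `HC_CM` ABSENT; with the arithmetic of Tankeev's exceptional set below `10`

HONEST FRAMING: research route conditional on HC_CM; not a corollary; Q11.4-sentence-2 already refuted in dim ≥ 3.

Cell `pub-hodge-ring2`, seat `pub-hodge-ring2-atlas-2` (generation 20). SUMMIT-SIDE binding of the Literature file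
`HodgeTheory/TankeevExceptionalNumbersHodgeClasses` (S. G. Tankeev, Izv. Math. 60 (1996), Thm. 1.1, first case, read
on the held refereed secondary text B. B. Gordon, Appendix B of Lewis' survey, Thm. 10.8
[corpus:paper:arxiv-alg-geom_9709030 p0028 L121–131, p0029 L15–17], as the named fact
`Tankeev1996_hodgeClassesAlgebraic_powers_simple_endRankOne_notEx1`: `A` simple, `End(A) ⊗ ℝ = ℝ`, `dim A ∉ Ex(1)` ⟹
(`hg(A,ℂ) = sp(2 dim A)` and) the Hodge conjecture for every power `Aᵏ`), in the class-target currency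
`Ring2.ClassTargets.HCOnClass` of the cell's kernel, exactly as `Ring2AtlasTypeIIRows` (generation 18) binds
Murty 1988. `HC_CM` (`Theses.RankFourFaces.CMAbelianHodge`, stmt-HodgeConjecture-3052) is NOT used anywhere in this
file: KIND of `HC_CM` = ABSENT. `HC_AV` = `Theses.PadicSemiregularLift.HodgeAbelianVarieties`
(stmt-HodgeConjecture-1333), by name, in the on-path lemmas only.

CONTENTS (theorems only; no `def`, no binder other than the one named print fact `hT`).
* §1 ARITHMETIC OF `Ex(1)` (PROVED, no hypothesis): `Ex(1) = {4^l, ½·C(4l+2,2l+1)^(2m−1), 2^(8lm+4l−4m−3),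
  4^l(m+1)^(2l+1) : l, m ≥ 1}` meets `{0, …, 9}` exactly in `{4}` (`eq_four_of_mem_tankeevEx1_of_lt_ten`; the four
  families start at `4, 10, 32, 32`), `4 ∈ Ex(1)` and `10 ∈ Ex(1)` (so the bound `10` is sharp), hence
  `6 ∉ Ex(1)` (`six_not_mem_tankeevEx1`) — and `2, 8 ∉ Ex(1)`.
* §2 modulo the fact ONLY: `HCOnClass (simple ∧ finrank_ℚ End⁰ = 1 ∧ dim ∉ Ex(1))`, the isogeny-closed POWER class
  "`X ∼ A^{N+1}`, `A` such" (isogeny by van Geemen's Lemma 3.7 = tree theorem `HodgeConjectureFor.of_isIsogenous`),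
  the FACTOR form (`X × Y ∼ A^{N+1}` ⟹ HC(`X`)), and the dimension window `dim A < 10, dim A ≠ 4`.
* §3 THE ATLAS ROW `g6.I(1)` (AV-HODGE-ATLAS §10 / §22 row 5 / §23): a SIMPLE complex abelian SIXFOLD with
  `End⁰(A) = ℚ` (`Module.finrank ℚ A.endAlgebra = 1`, i.e. `End(A) = ℤ`-rank one, `End(A) ⊗ ℝ = ℝ`): ALL POWERS
  `A^{N+1}` have the Hodge property modulo the one print fact (`hodgeConjectureFor_powSucc_simpleSixfold_endRankOne_of_tankeev1996`),
  the row as a class (`hcOnClass_simpleSixfold_endRankOne_of_tankeev1996`), everything isogenous to a power of a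
  member, and factors of such. MEMBERSHIP is DEFINITIONAL here (the typed class IS "dim 6, simple, `End⁰ = ℚ`"):
  unlike the type-II rows of generation 18 no prose membership step remains — every member is covered BY NAME.
* §4 ON PATH: every row is a case of `HC_AV` and of the summit (bookkeeping: nothing here is stronger than the
  Clay statement).

PRINT STATUS of the row (before: "KNOWN all powers GIVEN `Hg = Sp₁₂`", CELL INFERENCE, print locator null —
ADDENDUM §10 / §12 / §33 (d)): KNOWN for EVERY member and ALL powers — Tankeev 1996 Thm. 1.1 first case (Gordon
10.8): `End(A) ⊗ ℝ = ℝ`, `6 ∉ Ex(1)` ⟹ `hg(A,ℂ) = sp(12)`, i.e. `Hg(A) = Sp₁₂ = L(A)` for every simple sixfold with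
`End(A) = ℤ` (the row's INPUT pair is every member's pair: the "row ⟹ member" caveat of §22 is discharged by print
for this row, column 8 CELL INFERENCE → PRINT), and the general Hodge conjecture for every `Aᵏ`; consistent with
Tankeev 1994 Thm. 1 (Gordon 10.7: `End⁰(A) = ℚ`, `dim A` outside five families containing `Ex(1)` ⟹
`Hdg(A) = Div(A)`, `Hg(A) = Sp`) and with the Hazama–Murty criterion (Moonen–Zarhin 1999 (1.8): `Hg = Sp` ⟺ no
type-III factor and `B•(Xⁿ) = D•(Xⁿ)` for all `n`), which turns `Hg = Sp₁₂` into the cell's ENGINE-B numbers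
`b_p = d_p` on `X, …, X⁵` (AV-HODGE-ATLAS §9). TREE STATUS after this file: kernel row modulo ONE named print fact,
`HC_CM` absent (before: no tree object for the row at all — "NONE as a cell row (dim 6: no low-dimension theorem;
Hg = L untyped)", AV-HODGE-ATLAS gen-14 ledger table).

References: [Tankeev1996] Thm. 1.1; [Gordon1997] Thms. 10.7, 10.8 and §10 intro; [MoonenZarhin1999LowDim] (1.8);
[vanGeemen1994HodgeAV] Lemma 3.7; [MumfordAV1970] §19 (simple abelian varieties, Albert type I); [Deligne2000] §1.
-/

set_option linter.dupNamespace false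

noncomputable section

namespace Summit.HodgeConjecture.HodgeConjecture.Ring2.Atlas

open CategoryTheory
open Literature.AlgebraicGeometry Literature.AlgebraicGeometry.Motives
open Literature.AlgebraicGeometry.HodgeTheory
open Summit.HodgeConjecture.HodgeConjecture.Theses
open Summit.HodgeConjecture.HodgeConjecture.Ring2.ClassTargets

/-! ## §1 Arithmetic of Tankeev's exceptional set `Ex(1)` below `10` (proved; no hypothesis) -/

/-- **`Ex(1) ∩ {0,…,9} ⊆ {4}`**: a member of Tankeev's first exceptional set smaller than `10` equals `4`. The four
families start at `4^1 = 4`, `½·C(6,3) = 10`, `2^5 = 32` (exponent `8lm+4l−4m−3 ≥ 4m+1 ≥ 5`) and `4·2³ = 32`; and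
`4^l ≥ 16` for `l ≥ 2`. PROVED (elementary). [cite: Tankeev1996, Thm. 1.1 (the set Ex(1))] [cite: Gordon1997, Thm. 10.8] -/
theorem eq_four_of_mem_tankeevEx1_of_lt_ten {g : ℕ} (hg : g ∈ tankeevEx1) (h10 : g < 10) : g = 4 := by
  obtain ⟨l, m, hl, hm, h | h | h | h⟩ := hg
  · -- `g = 4 ^ l`
    rcases Nat.lt_or_ge l 2 with hl2 | hl2
    · interval_cases l
      simpa using h
    · have h16 : 4 ^ 2 ≤ 4 ^ l := Nat.pow_le_pow_right (by norm_num) hl2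
      omega
  · -- `2 * g = C(4l+2, 2l+1) ^ (2m-1)`, and `C(4l+2, 2l+1) ≥ C(6,3) = 20`
    have h20 : 20 ≤ Nat.choose (4 * l + 2) (2 * l + 1) := by
      have hmid : (4 * l + 2) / 2 = 2 * l + 1 := by omega
      calc 20 = Nat.choose 6 3 := by decide
        _ ≤ Nat.choose (4 * l + 2) 3 := Nat.choose_le_choose 3 (by omega)
        _ ≤ Nat.choose (4 * l + 2) ((4 * l + 2) / 2) := Nat.choose_le_middle 3 (4 * l + 2)
        _ = Nat.choose (4 * l + 2) (2 * l + 1) := by rw [hmid]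
    have hpow : Nat.choose (4 * l + 2) (2 * l + 1) ≤ Nat.choose (4 * l + 2) (2 * l + 1) ^ (2 * m - 1) :=
      le_self_pow (by omega) (by omega)
    omega
  · -- `g = 2 ^ (8lm+4l-4m-3)` with exponent `≥ 5`
    have hlm : m ≤ l * m := Nat.le_mul_of_pos_left m hl
    have he : 5 ≤ 8 * l * m + 4 * l - 4 * m - 3 := by
      have : 8 * l * m = 8 * (l * m) := by ring
      omega
    have h32 : 2 ^ 5 ≤ 2 ^ (8 * l * m + 4 * l - 4 * m - 3) := Nat.pow_le_pow_right (by norm_num) he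
    omega
  · -- `g = 4 ^ l * (m+1) ^ (2l+1) ≥ 4 * 8`
    have h4 : 4 ≤ 4 ^ l := le_self_pow (by norm_num) (by omega)
    have h8 : 2 ^ 3 ≤ (m + 1) ^ (2 * l + 1) :=
      calc 2 ^ 3 ≤ (m + 1) ^ 3 := Nat.pow_le_pow_left (by omega) 3
        _ ≤ (m + 1) ^ (2 * l + 1) := Nat.pow_le_pow_right (by omega) (by omega)
    have h32 : 4 * 2 ^ 3 ≤ 4 ^ l * (m + 1) ^ (2 * l + 1) := Nat.mul_le_mul h4 h8
    omega

/-- **`4 ∈ Ex(1)`** (`4 = 4^1`: the dimension of Mumford's examples). PROVED. [cite: Tankeev1996, Thm. 1.1 (the set Ex(1))]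
[cite: Gordon1997, Thm. 10.8 and 7.9] -/
theorem four_mem_tankeevEx1 : 4 ∈ tankeevEx1 :=
  ⟨1, 1, Nat.one_pos, Nat.one_pos, Or.inl (by norm_num)⟩

/-- **`10 ∈ Ex(1)`** (`2·10 = C(6,3)^1`): the bound `10` of `eq_four_of_mem_tankeevEx1_of_lt_ten` is sharp. PROVED.
[cite: Tankeev1996, Thm. 1.1 (the set Ex(1))] [cite: Gordon1997, Thm. 10.8] -/
theorem ten_mem_tankeevEx1 : 10 ∈ tankeevEx1 :=
  ⟨1, 1, Nat.one_pos, Nat.one_pos, Or.inr (Or.inl (by decide))⟩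

/-- **`16 ∈ Ex(1)`** (`16 = 4^2`). PROVED. [cite: Tankeev1996, Thm. 1.1 (the set Ex(1))] [cite: Gordon1997, Thm. 10.8] -/
theorem sixteen_mem_tankeevEx1 : 16 ∈ tankeevEx1 :=
  ⟨2, 1, by norm_num, Nat.one_pos, Or.inl (by norm_num)⟩

/-- **`32 ∈ Ex(1)`** (`32 = 2^(8+4−4−3) = 2^5`, also `= 4·2³`). PROVED. [cite: Tankeev1996, Thm. 1.1 (the set Ex(1))]
[cite: Gordon1997, Thm. 10.8] -/
theorem thirtyTwo_mem_tankeevEx1 : 32 ∈ tankeevEx1 :=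
  ⟨1, 1, Nat.one_pos, Nat.one_pos, Or.inr (Or.inr (Or.inl (by norm_num)))⟩

/-- **Below `10` only `4` is exceptional**: `g < 10`, `g ≠ 4` ⟹ `g ∉ Ex(1)`. PROVED.
[cite: Tankeev1996, Thm. 1.1 (the set Ex(1))] [cite: Gordon1997, Thm. 10.8] -/
theorem not_mem_tankeevEx1_of_lt_ten_of_ne_four {g : ℕ} (h10 : g < 10) (h4 : g ≠ 4) : g ∉ tankeevEx1 :=
  fun hg ↦ h4 (eq_four_of_mem_tankeevEx1_of_lt_ten hg h10)

/-- **`6 ∉ Ex(1)`**: the dimension of the atlas row `g6.I(1)` is NOT exceptional. PROVED.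
[cite: Tankeev1996, Thm. 1.1 (the set Ex(1))] [cite: Gordon1997, Thm. 10.8] -/
theorem six_not_mem_tankeevEx1 : 6 ∉ tankeevEx1 :=
  not_mem_tankeevEx1_of_lt_ten_of_ne_four (by norm_num) (by norm_num)

/-- `2 ∉ Ex(1)`. PROVED. [cite: Tankeev1996, Thm. 1.1 (the set Ex(1))] -/
theorem two_not_mem_tankeevEx1 : 2 ∉ tankeevEx1 :=
  not_mem_tankeevEx1_of_lt_ten_of_ne_four (by norm_num) (by norm_num)

/-- `8 ∉ Ex(1)`. PROVED. [cite: Tankeev1996, Thm. 1.1 (the set Ex(1))] -/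
theorem eight_not_mem_tankeevEx1 : 8 ∉ tankeevEx1 :=
  not_mem_tankeevEx1_of_lt_ten_of_ne_four (by norm_num) (by norm_num)

/-! ## §2 The rows, modulo Tankeev's Thm. 1.1 (first case) only -/

/-- **ROW: the Hodge conjecture on the class of SIMPLE abelian varieties with `End⁰(A) = ℚ` and non-exceptional
dimension** (`A` itself, `N = 0`), modulo the fact. KIND of `HC_CM`: ABSENT. [cite: Tankeev1996, Thm. 1.1 (first case)]
[cite: Gordon1997, Thm. 10.8] [cite: Deligne2000, §1] -/
theorem hcOnClass_simple_endRankOne_notEx1_of_tankeev1996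
    (hT : Tankeev1996_hodgeClassesAlgebraic_powers_simple_endRankOne_notEx1) :
    HCOnClass fun A ↦ A.IsSimple ∧ Module.finrank ℚ A.endAlgebra = 1 ∧ A.dim ∉ tankeevEx1 :=
  fun A hA ↦ hodgeConjectureFor_self_of_tankeev1996 hT A hA.1 hA.2.1 hA.2.2

/-- **ROW: the Hodge conjecture on the isogeny-closed POWER class** — `X` isogenous to some power `A^{N+1}` of a
simple abelian variety with `End⁰(A) = ℚ` and `dim A ∉ Ex(1)` — modulo the fact: powers by the Literature feeder,
the isogeny by van Geemen's Lemma 3.7 (`HodgeConjectureFor.of_isIsogenous`, a tree theorem). KIND of `HC_CM`: ABSENT.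
[cite: Tankeev1996, Thm. 1.1 (first case)] [cite: vanGeemen1994HodgeAV, Lemma 3.7] [cite: Deligne2000, §1] -/
theorem hcOnClass_isogenousPowSucc_simple_endRankOne_notEx1_of_tankeev1996
    (hT : Tankeev1996_hodgeClassesAlgebraic_powers_simple_endRankOne_notEx1) :
    HCOnClass fun X ↦ ∃ (A : AbelianVariety ℂ) (N : ℕ), A.IsSimple ∧ Module.finrank ℚ A.endAlgebra = 1 ∧
      A.dim ∉ tankeevEx1 ∧ AbelianVariety.IsIsogenous X (A.powSucc N) := by
  rintro X ⟨A, N, hs, h1, hEx, hX⟩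
  exact HodgeConjectureFor.of_isIsogenous hX (hodgeConjectureFor_powSucc_of_tankeev1996 hT A hs h1 hEx N)

/-- **FACTOR form**: if `X × Y` is isogenous to a power `A^{N+1}` of a simple abelian variety with `End⁰(A) = ℚ` and
`dim A ∉ Ex(1)`, then HC(`X`) (restriction to the slice `X × {0}`, `hodgeConjectureFor_left_of_prod`) — e.g. the
abelian subvarieties of `A^{N+1}` up to isogeny (Poincaré reducibility supplies the complement `Y`).
[cite: Tankeev1996, Thm. 1.1 (first case)] [cite: vanGeemen1994HodgeAV, Lemma 3.7] -/
theorem hodgeConjectureFor_of_prod_isIsogenous_powSucc_of_tankeev1996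
    (hT : Tankeev1996_hodgeClassesAlgebraic_powers_simple_endRankOne_notEx1) (X Y : AbelianVariety ℂ)
    {A : AbelianVariety ℂ} (hs : A.IsSimple) (h1 : Module.finrank ℚ A.endAlgebra = 1) (hEx : A.dim ∉ tankeevEx1)
    (N : ℕ) (hXY : AbelianVariety.IsIsogenous (X.prod Y) (A.powSucc N)) : HodgeConjectureFor X.dim X.X :=
  hodgeConjectureFor_left_of_prod X Y
    (hcOnClass_isogenousPowSucc_simple_endRankOne_notEx1_of_tankeev1996 hT (X.prod Y) ⟨A, N, hs, h1, hEx, hXY⟩)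

/-- **ROW (dimension window): simple, `End⁰(A) = ℚ`, `dim A < 10`, `dim A ≠ 4` — ALL POWERS**, modulo the fact
(§1: below `10` only `4` is exceptional). Covers the `End(A) = ℤ` rows of dimensions `2, 3, 5, 6, 7, 8, 9`; the odd
ones are also Ribet 1983 / Tankeev 1982 (`RibetTotallyRealHodgeClasses`), `6` and `8` are new to the tree.
KIND of `HC_CM`: ABSENT. [cite: Tankeev1996, Thm. 1.1 (first case)] [cite: Gordon1997, Thm. 10.8] -/
theorem hodgeConjectureFor_powSucc_simple_endRankOne_lt_ten_of_tankeev1996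
    (hT : Tankeev1996_hodgeClassesAlgebraic_powers_simple_endRankOne_notEx1) (A : AbelianVariety ℂ) (hs : A.IsSimple)
    (h1 : Module.finrank ℚ A.endAlgebra = 1) (h10 : A.dim < 10) (h4 : A.dim ≠ 4) (N : ℕ) :
    HodgeConjectureFor (A.powSucc N).dim (A.powSucc N).X :=
  hodgeConjectureFor_powSucc_of_tankeev1996 hT A hs h1 (not_mem_tankeevEx1_of_lt_ten_of_ne_four h10 h4) N

/-- **The dimension window as a class.** KIND of `HC_CM`: ABSENT. [cite: Tankeev1996, Thm. 1.1 (first case)]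
[cite: Deligne2000, §1] -/
theorem hcOnClass_simple_endRankOne_lt_ten_ne_four_of_tankeev1996
    (hT : Tankeev1996_hodgeClassesAlgebraic_powers_simple_endRankOne_notEx1) :
    HCOnClass fun A ↦ A.IsSimple ∧ Module.finrank ℚ A.endAlgebra = 1 ∧ A.dim < 10 ∧ A.dim ≠ 4 :=
  fun A hA ↦ hodgeConjectureFor_powSucc_simple_endRankOne_lt_ten_of_tankeev1996 hT A hA.1 hA.2.1 hA.2.2.1 hA.2.2.2 0

/-! ## §3 The atlas row `g6.I(1)`: simple sixfolds with `End(A) = ℤ` -/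

/-- **ATLAS ROW `g6.I(1)`: a SIMPLE complex abelian SIXFOLD with `End⁰(A) = ℚ` — ALL POWERS `A^{N+1}` have the
Hodge property, modulo Tankeev's Thm. 1.1** (`6 ∉ Ex(1)`, §1). In print for the same members: `Hg(A) = Sp₁₂ = L(A)`.
KIND of `HC_CM`: ABSENT. [cite: Tankeev1996, Thm. 1.1 (first case)] [cite: Gordon1997, Thm. 10.8]
[cite: MoonenZarhin1999LowDim, (1.8)] -/
theorem hodgeConjectureFor_powSucc_simpleSixfold_endRankOne_of_tankeev1996
    (hT : Tankeev1996_hodgeClassesAlgebraic_powers_simple_endRankOne_notEx1) (A : AbelianVariety ℂ) (hA : A.dim = 6)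
    (hs : A.IsSimple) (h1 : Module.finrank ℚ A.endAlgebra = 1) (N : ℕ) :
    HodgeConjectureFor (A.powSucc N).dim (A.powSucc N).X :=
  hodgeConjectureFor_powSucc_of_tankeev1996 hT A hs h1 (by rw [hA]; exact six_not_mem_tankeevEx1) N

/-- **ATLAS ROW `g6.I(1)` as a class target**: `HCOnClass (dim A = 6 ∧ A simple ∧ finrank_ℚ End⁰(A) = 1)`, modulo
the fact — membership is definitional (every member covered by name). KIND of `HC_CM`: ABSENT.
[cite: Tankeev1996, Thm. 1.1 (first case)] [cite: Deligne2000, §1] -/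
theorem hcOnClass_simpleSixfold_endRankOne_of_tankeev1996
    (hT : Tankeev1996_hodgeClassesAlgebraic_powers_simple_endRankOne_notEx1) :
    HCOnClass fun A ↦ A.dim = 6 ∧ A.IsSimple ∧ Module.finrank ℚ A.endAlgebra = 1 :=
  fun A hA ↦ hodgeConjectureFor_powSucc_simpleSixfold_endRankOne_of_tankeev1996 hT A hA.1 hA.2.1 hA.2.2 0

/-- **… together with everything isogenous to a POWER of such a sixfold** (the isotypic cells `X ∼ Aᵏ`, `dim X = 6k`).
KIND of `HC_CM`: ABSENT. [cite: Tankeev1996, Thm. 1.1 (first case)] [cite: vanGeemen1994HodgeAV, Lemma 3.7] -/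
theorem hcOnClass_isogenousPowSucc_simpleSixfold_endRankOne_of_tankeev1996
    (hT : Tankeev1996_hodgeClassesAlgebraic_powers_simple_endRankOne_notEx1) :
    HCOnClass fun X ↦ ∃ (A : AbelianVariety ℂ) (N : ℕ), A.dim = 6 ∧ A.IsSimple ∧
      Module.finrank ℚ A.endAlgebra = 1 ∧ AbelianVariety.IsIsogenous X (A.powSucc N) := by
  rintro X ⟨A, N, hA, hs, h1, hX⟩
  exact HodgeConjectureFor.of_isIsogenous hX
    (hodgeConjectureFor_powSucc_simpleSixfold_endRankOne_of_tankeev1996 hT A hA hs h1 N)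

/-- **FACTOR form for the row**: abelian subvarieties (up to isogeny, with a complement) of a power of a simple
sixfold with `End(A) = ℤ` have the Hodge property, modulo the fact. [cite: Tankeev1996, Thm. 1.1 (first case)]
[cite: vanGeemen1994HodgeAV, Lemma 3.7] -/
theorem hodgeConjectureFor_of_prod_isIsogenous_powSucc_simpleSixfold_of_tankeev1996
    (hT : Tankeev1996_hodgeClassesAlgebraic_powers_simple_endRankOne_notEx1) (X Y : AbelianVariety ℂ)
    {A : AbelianVariety ℂ} (hA : A.dim = 6) (hs : A.IsSimple) (h1 : Module.finrank ℚ A.endAlgebra = 1) (N : ℕ)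
    (hXY : AbelianVariety.IsIsogenous (X.prod Y) (A.powSucc N)) : HodgeConjectureFor X.dim X.X :=
  hodgeConjectureFor_of_prod_isIsogenous_powSucc_of_tankeev1996 hT X Y hs h1
    (by rw [hA]; exact six_not_mem_tankeevEx1) N hXY

/-! ## §4 On path: every row is a case of `HC_AV` and of the summit -/

/-- ON-PATH: the non-exceptional simple `End⁰ = ℚ` class is a case of `HC_AV` (stmt-HodgeConjecture-1333 by name).
[cite: Deligne2000, §1] -/
theorem hcOnClass_simple_endRankOne_notEx1_of_hodgeAbelianVarieties (h : PadicSemiregularLift.HodgeAbelianVarieties) :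
    HCOnClass fun A ↦ A.IsSimple ∧ Module.finrank ℚ A.endAlgebra = 1 ∧ A.dim ∉ tankeevEx1 :=
  hcOnClass_of_hodgeAbelianVarieties _ h

/-- ON-PATH: the row `g6.I(1)` is a case of `HC_AV`. [cite: Deligne2000, §1] -/
theorem hcOnClass_simpleSixfold_endRankOne_of_hodgeAbelianVarieties (h : PadicSemiregularLift.HodgeAbelianVarieties) :
    HCOnClass fun A ↦ A.dim = 6 ∧ A.IsSimple ∧ Module.finrank ℚ A.endAlgebra = 1 :=
  hcOnClass_of_hodgeAbelianVarieties _ h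

/-- ON-PATH: … and of the summit. [cite: Deligne2000, §1] -/
theorem hcOnClass_simpleSixfold_endRankOne_of_hodgeConjecture (h : _root_.HodgeConjecture) :
    HCOnClass fun A ↦ A.dim = 6 ∧ A.IsSimple ∧ Module.finrank ℚ A.endAlgebra = 1 :=
  hcOnClass_of_hodgeConjecture _ h

/-- ON-PATH: the row in its `∀`-spelling (all powers) is a case of `HC_AV` (powers of abelian varieties are abelian
varieties). [cite: Deligne2000, §1] -/
theorem hodgeConjectureFor_powSucc_simpleSixfold_endRankOne_of_hodgeAbelianVarieties
    (h : PadicSemiregularLift.HodgeAbelianVarieties) (A : AbelianVariety ℂ) (_hA : A.dim = 6) (_hs : A.IsSimple)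
    (_h1 : Module.finrank ℚ A.endAlgebra = 1) (N : ℕ) : HodgeConjectureFor (A.powSucc N).dim (A.powSucc N).X :=
  h (A.powSucc N)

/-- ON-PATH: … and of the summit. [cite: Deligne2000, §1] -/
theorem hodgeConjectureFor_powSucc_simpleSixfold_endRankOne_of_hodgeConjecture (h : _root_.HodgeConjecture)
    (A : AbelianVariety ℂ) (_hA : A.dim = 6) (_hs : A.IsSimple) (_h1 : Module.finrank ℚ A.endAlgebra = 1) (N : ℕ) :
    HodgeConjectureFor (A.powSucc N).dim (A.powSucc N).X :=
  h (AbelianVariety.isSmoothProjective_holds (A := A.powSucc N))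

end Summit.HodgeConjecture.HodgeConjecture.Ring2.Atlas

end
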